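import Literature.Algebra.EuclideanLattices.GaussLattice3D
import HarnessLib

/-!
# The face-centred and body-centred cubic lattices of `ℝ³` at unit density

Topic: `Literature/Algebra/EuclideanLattices`.

Conway–Sloane, *Sphere Packings, Lattices and Groups*, Ch. 4 §6.3: the fcc lattice is
`D₃ = {(x, y, z) ∈ ℤ³ : x + y + z even}` ("det = 4", i.e. covolume `2`, minimal norm `2`),
`A₃ ≅ D₃`; Ch. 4 §6.7 / §7.1: its dual `D₃*` is the body-centred cubic lattice
`ℤ³ ∪ (ℤ³ + (½, ½, ½))`; Ch. 1 §1.4, Table 1.2: `D₃ ≅ A₃` is the densest lattice packing in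
`ℝ³` (Gauss), Hermite constant `γ₃ = 2^{1/3}`.

## What is here (explicit competitors, used by `HermiteConstantThree.lean` and by the
crystallization barrier `NoUniversallyOptimalLattice3D`)

* `exists_fccLattice` — a full lattice `F ⊂ ℝ³` of covolume `1` all of whose nonzero vectors
  have `‖x‖² ≥ 2^{1/3}`: `F = 2^{-1/3} D₃` with basis `2^{-1/3}·{(1,1,0), (-1,0,1), (1,-1,0)}`.
* `exists_bccLattice` — a full lattice `B ⊂ ℝ³` of covolume `1` whose *dual* lattice has all
  nonzero vectors of squared norm `≥ 2^{1/3}`: `B = 4^{-1/3}·(2ℤ³ ∪ (2ℤ³ + (1,1,1)))` with basis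
  `4^{-1/3}·{(1,1,1), (0,0,2), (1,-1,1)}` (the dual basis is the fcc basis above).
* the integer lemma `two_le_dThreeForm`: `(a - b + c)² + (a - c)² + b² ≥ 2` for
  `(a, b, c) ≠ 0` (the squared length of a nonzero `D₃` vector is an even positive integer).

Both lattices are produced as `Submodule.span ℤ (Set.range b)` for an explicit real basis `b`
(so Mathlib's `ZSpan` instances apply) with `ZLattice.covolume = |det b| = 1`
(`covolume_span_eq_abs_det`). Not here: the identification with the point sets
`fccUnitDensity`, `bccUnitDensity` of the barrier file, theta series, kissing numbers.

## References

* J. H. Conway, N. J. A. Sloane, *SPLAG*, 3rd ed. (1999), Ch. 4 §6.3 (`D₃`, eq. (86)–(90)),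
  §7.1 (`Dₙ*`), Ch. 1 §1.4 (Table 1.2, `γ₃`).
-/

noncomputable section

open Module Submodule MeasureTheory
open scoped InnerProductSpace

namespace Literature.Algebra.EuclideanLattices

/-! ## Coordinates in `ℝ³` -/

/-- `⟪x, y⟫ = x₀y₀ + x₁y₁ + x₂y₂` in `ℝ³`. [folklore] -/
theorem inner_fin_three (x y : EuclideanSpace ℝ (Fin 3)) :
    ⟪x, y⟫_ℝ = x 0 * y 0 + x 1 * y 1 + x 2 * y 2 := by
  simp [PiLp.inner_apply, Fin.sum_univ_three, mul_comm]

/-- `‖x‖² = x₀² + x₁² + x₂²` in `ℝ³`. [folklore] -/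
theorem norm_sq_fin_three (x : EuclideanSpace ℝ (Fin 3)) :
    ‖x‖ ^ 2 = x 0 ^ 2 + x 1 ^ 2 + x 2 ^ 2 := by
  rw [← real_inner_self_eq_norm_sq, inner_fin_three]; ring

/-- The integer quadratic form `(a - b + c)² + (a - c)² + b²` (the squared length of the `D₃`
vector `a(1,1,0) + b(-1,0,1) + c(1,-1,0)`) is even and positive, hence `≥ 2`, unless
`a = b = c = 0` (Conway–Sloane Ch. 4 §6.3: `D₃` has minimal norm `2`).
[cite: ConwaySloane1999, Ch. 4 §6.3] -/
theorem two_le_dThreeForm {a b c : ℤ} (h : ¬(a = 0 ∧ b = 0 ∧ c = 0)) :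
    2 ≤ (a - b + c) ^ 2 + (a - c) ^ 2 + b ^ 2 := by
  have hsq : ∀ n : ℤ, Even (n ^ 2 - n) := fun n => by
    obtain ⟨k, hk⟩ := Int.even_mul_succ_self (n - 1)
    exact ⟨k, by linear_combination hk⟩
  have hpos : 0 < (a - b + c) ^ 2 + (a - c) ^ 2 + b ^ 2 := by
    rcases lt_trichotomy 0 ((a - b + c) ^ 2 + (a - c) ^ 2 + b ^ 2) with hlt | heq | hgt
    · exact hlt
    · exfalso
      have hb : b ^ 2 = 0 := by nlinarith [sq_nonneg (a - b + c), sq_nonneg (a - c), sq_nonneg b]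
      have hac : (a - c) ^ 2 = 0 := by nlinarith [sq_nonneg (a - b + c), sq_nonneg (a - c)]
      have habc : (a - b + c) ^ 2 = 0 := by nlinarith [sq_nonneg (a - b + c)]
      have hb' : b = 0 := (pow_eq_zero_iff two_ne_zero).mp hb
      have hac' : a - c = 0 := (pow_eq_zero_iff two_ne_zero).mp hac
      have habc' : a - b + c = 0 := (pow_eq_zero_iff two_ne_zero).mp habc
      exact h ⟨by omega, hb', by omega⟩
    · nlinarith [sq_nonneg (a - b + c), sq_nonneg (a - c), sq_nonneg b]
  have heven : Even ((a - b + c) ^ 2 + (a - c) ^ 2 + b ^ 2) := by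
    have : (a - b + c) ^ 2 + (a - c) ^ 2 + b ^ 2 =
        ((a - b + c) ^ 2 - (a - b + c)) + ((a - c) ^ 2 - (a - c)) + (b ^ 2 - b) + 2 * a := by ring
    rw [this]
    exact (((hsq _).add (hsq _)).add (hsq _)).add (even_two_mul a)
  obtain ⟨k, hk⟩ := heven
  generalize (a - b + c) ^ 2 + (a - c) ^ 2 + b ^ 2 = q at hpos hk ⊢
  omega

/-! ## The competitors: fcc and bcc at unit density -/

/-- `(2^{1/3})³ = 2`. [folklore] -/
theorem two_rpow_third_pow_three : ((2 : ℝ) ^ ((1 : ℝ) / 3)) ^ 3 = 2 := by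
  rw [← Real.rpow_natCast, ← Real.rpow_mul (by norm_num)]; norm_num

/-- **The face-centred cubic lattice at unit density as a competitor**: there is a full lattice
`F ⊂ ℝ³` of covolume `1` all of whose nonzero vectors have `‖x‖² ≥ 2^{1/3}`, namely
`2^{-1/3} D₃` with basis `2^{-1/3}·{(1,1,0), (-1,0,1), (1,-1,0)}` (`D₃ = {v ∈ ℤ³ : ∑ vᵢ even}`
has determinant `2` and minimal norm `2`; Conway–Sloane Ch. 4 §6.3, fcc `≅ D₃ ≅ A₃`).
[cite: ConwaySloane1999, Ch. 4 §6.3] -/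
theorem exists_fccLattice :
    ∃ (F : Submodule ℤ (EuclideanSpace ℝ (Fin 3))) (_ : DiscreteTopology F) (_ : IsZLattice ℝ F),
      ZLattice.covolume F = 1 ∧ ∀ x ∈ F, x ≠ 0 → (2 : ℝ) ^ ((1 : ℝ) / 3) ≤ ‖x‖ ^ 2 := by
  set μ : ℝ := (2 : ℝ) ^ ((1 : ℝ) / 3) with hμ
  have hμ0 : 0 < μ := by positivity
  have hμ3 : μ ^ 3 = 2 := two_rpow_third_pow_three
  set t : ℝ := μ⁻¹ with ht
  have ht0 : 0 < t := inv_pos.mpr hμ0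
  have ht3 : t ^ 3 * 2 = 1 := by rw [ht, inv_pow, hμ3]; norm_num
  have ht2 : t ^ 2 * 2 = μ := by
    rw [ht]; field_simp; linarith [hμ3]
  -- the unscaled `D₃` basis and its independence
  let a : Fin 3 → EuclideanSpace ℝ (Fin 3) := ![!₂[1, 1, 0], !₂[-1, 0, 1], !₂[1, -1, 0]]
  have ha : LinearIndependent ℝ a := by
    rw [Fintype.linearIndependent_iff]
    intro g hg i
    have h0 := congrArg (fun x : EuclideanSpace ℝ (Fin 3) => x 0) hg
    have h1 := congrArg (fun x : EuclideanSpace ℝ (Fin 3) => x 1) hg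
    have h2 := congrArg (fun x : EuclideanSpace ℝ (Fin 3) => x 2) hg
    simp [Fin.sum_univ_three, a] at h0 h1 h2
    have g0 : g 0 = 0 := by linarith
    have g1 : g 1 = 0 := by linarith
    have g2 : g 2 = 0 := by linarith
    fin_cases i <;> assumption
  let tu : Fin 3 → ℝˣ := fun _ => Units.mk0 t ht0.ne'
  have hf : LinearIndependent ℝ (tu • a) := ha.units_smul tu
  let b : Basis (Fin 3) ℝ (EuclideanSpace ℝ (Fin 3)) :=
    basisOfLinearIndependentOfCardEqFinrank hf (by simp)
  have hb : ∀ i, b i = t • a i := fun i => by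
    simp [b, tu, Units.smul_def]
  refine ⟨span ℤ (Set.range b), inferInstance, inferInstance, ?_, ?_⟩
  · -- covolume
    have hdet : (Matrix.of fun i j => b i j).det = 2 * t ^ 3 := by
      rw [Matrix.det_fin_three]
      simp [hb, a]
      ring
    rw [covolume_span_eq_abs_det b, hdet, abs_of_pos (by positivity)]
    linear_combination ht3
  · -- minimal norm
    intro x hx hx0
    have hrange : Set.range ⇑b = {b 0, b 1, b 2} := by
      rw [← range_vec_three]; congr 1; ext i; fin_cases i <;> rfl
    rw [hrange, mem_span_triple] at hx
    obtain ⟨p, q, r, rfl⟩ := hx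
    have hpqr : ¬(p = 0 ∧ q = 0 ∧ r = 0) := by
      rintro ⟨rfl, rfl, rfl⟩; simp at hx0
    have hform := two_le_dThreeForm hpqr
    have hnorm : ‖p • b 0 + q • b 1 + r • b 2‖ ^ 2 =
        t ^ 2 * (((p - q + r) ^ 2 + (p - r) ^ 2 + q ^ 2 : ℤ) : ℝ) := by
      rw [norm_sq_fin_three, ← Int.cast_smul_eq_zsmul ℝ p, ← Int.cast_smul_eq_zsmul ℝ q,
        ← Int.cast_smul_eq_zsmul ℝ r]
      simp [hb, a]
      ring
    rw [hnorm, ← ht2]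
    have : (2 : ℝ) ≤ (((p - q + r) ^ 2 + (p - r) ^ 2 + q ^ 2 : ℤ) : ℝ) := by exact_mod_cast hform
    nlinarith [sq_nonneg t]

/-- **The body-centred cubic lattice at unit density as a competitor**: there is a full lattice
`B ⊂ ℝ³` of covolume `1` whose dual lattice has all nonzero vectors of squared norm
`≥ 2^{1/3}`, namely `B = 4^{-1/3}·{v ∈ ℤ³ : v₁ ≡ v₂ ≡ v₃ (2)}` with basis
`4^{-1/3}·{(1,1,1), (0,0,2), (1,-1,1)}` (determinant `4`), the lattice dual to the unit fcc
lattice `2^{-1/3} D₃` (Conway–Sloane Ch. 4 §6.3, §7.1: `D₃* ≅` bcc; the dual basis of the above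
is the fcc basis `2^{-1/3}·{(1,1,0), (-1,0,1), (1,-1,0)}`). [cite: ConwaySloane1999, Ch. 4 §7.1] -/
theorem exists_bccLattice :
    ∃ (B : Submodule ℤ (EuclideanSpace ℝ (Fin 3))) (_ : DiscreteTopology B) (_ : IsZLattice ℝ B),
      ZLattice.covolume B = 1 ∧
        ∀ y ∈ dualLattice B, y ≠ 0 → (2 : ℝ) ^ ((1 : ℝ) / 3) ≤ ‖y‖ ^ 2 := by
  set μ : ℝ := (2 : ℝ) ^ ((1 : ℝ) / 3) with hμ
  have hμ0 : 0 < μ := by positivity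
  have hμ3 : μ ^ 3 = 2 := two_rpow_third_pow_three
  set s : ℝ := (μ ^ 2)⁻¹ with hs
  have hs0 : 0 < s := by positivity
  have hs3 : s ^ 3 * 4 = 1 := by
    rw [hs, inv_pow, ← pow_mul, show 2 * 3 = 3 * 2 by norm_num, pow_mul, hμ3]; norm_num
  have hμ4 : μ ^ 4 = 2 * μ := by
    calc μ ^ 4 = μ * μ ^ 3 := by ring
      _ = 2 * μ := by rw [hμ3]; ring
  have hs2 : μ * (2 * s) ^ 2 = 2 := by
    rw [hs]; field_simp; linarith [hμ4]
  let a : Fin 3 → EuclideanSpace ℝ (Fin 3) := ![!₂[1, 1, 1], !₂[0, 0, 2], !₂[1, -1, 1]]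
  have ha : LinearIndependent ℝ a := by
    rw [Fintype.linearIndependent_iff]
    intro g hg i
    have h0 := congrArg (fun x : EuclideanSpace ℝ (Fin 3) => x 0) hg
    have h1 := congrArg (fun x : EuclideanSpace ℝ (Fin 3) => x 1) hg
    have h2 := congrArg (fun x : EuclideanSpace ℝ (Fin 3) => x 2) hg
    simp [Fin.sum_univ_three, a] at h0 h1 h2
    have g0 : g 0 = 0 := by linarith
    have g1 : g 1 = 0 := by linarith
    have g2 : g 2 = 0 := by linarith
    fin_cases i <;> assumption
  let su : Fin 3 → ℝˣ := fun _ => Units.mk0 s hs0.ne'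
  have hf : LinearIndependent ℝ (su • a) := ha.units_smul su
  let b : Basis (Fin 3) ℝ (EuclideanSpace ℝ (Fin 3)) :=
    basisOfLinearIndependentOfCardEqFinrank hf (by simp)
  have hb : ∀ i, b i = s • a i := fun i => by
    simp [b, su, Units.smul_def]
  refine ⟨span ℤ (Set.range b), inferInstance, inferInstance, ?_, ?_⟩
  · -- covolume
    have hdet : (Matrix.of fun i j => b i j).det = 4 * s ^ 3 := by
      rw [Matrix.det_fin_three]
      simp [hb, a]
      ring
    rw [covolume_span_eq_abs_det b, hdet, abs_of_pos (by positivity)]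
    linear_combination hs3
  · -- the dual lattice
    intro y hy hy0
    rw [mem_dualLattice] at hy
    obtain ⟨k₀, hk₀⟩ := hy (b 0) (subset_span ⟨0, rfl⟩)
    obtain ⟨k₁, hk₁⟩ := hy (b 1) (subset_span ⟨1, rfl⟩)
    obtain ⟨k₂, hk₂⟩ := hy (b 2) (subset_span ⟨2, rfl⟩)
    rw [inner_fin_three, hb] at hk₀ hk₁ hk₂
    simp [a] at hk₀ hk₁ hk₂
    have hs0' : s ≠ 0 := hs0.ne'
    -- solve for the coordinates of `y`
    have hy₀ : y 0 = (k₀ + k₂ - k₁) / (2 * s) := by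
      field_simp; linarith
    have hy₁ : y 1 = (k₀ - k₂) / (2 * s) := by
      field_simp; linarith
    have hy₂ : y 2 = k₁ / (2 * s) := by
      field_simp; linarith
    have hk : ¬(k₀ = 0 ∧ k₁ = 0 ∧ k₂ = 0) := by
      rintro ⟨rfl, rfl, rfl⟩
      apply hy0
      ext i
      fin_cases i <;> simp [hy₀, hy₁, hy₂]
    have hform := two_le_dThreeForm hk
    have hnorm : ‖y‖ ^ 2 =
        (((k₀ - k₁ + k₂) ^ 2 + (k₀ - k₂) ^ 2 + k₁ ^ 2 : ℤ) : ℝ) / (2 * s) ^ 2 := by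
      rw [norm_sq_fin_three, hy₀, hy₁, hy₂]
      push_cast
      field_simp
      ring
    have : (2 : ℝ) ≤ (((k₀ - k₁ + k₂) ^ 2 + (k₀ - k₂) ^ 2 + k₁ ^ 2 : ℤ) : ℝ) := by
      exact_mod_cast hform
    rw [hnorm, le_div_iff₀ (by positivity), hs2]
    exact this

end Literature.Algebra.EuclideanLattices
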